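import Summits.QuantumFields.BalabanUV.Beta.D1BFx.SbpShellAlgebra

/-!
# `BalabanUV.Beta.D1BFx.SbpShellTerm` — road «BF-x» for binder row D1: THE SUMMATION-BY-PARTS SCALAR WALL, PART 2 OF 4 —
# the Abel-summed term `Σ_w φ(w)·(ψ(w+e_ν) − ψ(w))` is `O(1)` uniformly in the blocking factor `n`, from FIRST-ORDER rows only

HONEST DEPENDENCY (page 1, mandatory): continuum YM on T⁴ ⇐ BetaPertH ∧ nine spine estimates (0/9 proved); BetaPertH ⇐ (D1) ∧ (D4) ∧ CAP+tail;
G-an2-4 gates asym, D1 and NE2/3/4.  HONEST FRAMING (cell contract, verbatim): «discharging `BetaPertH` makes Bałaban's UV stability UNCONDITIONAL —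
a real constructive-QFT result; it is NOT the continuum limit and NOT the Clay problem.»  THIS MODULE DISCHARGES NOTHING of the wall by itself:
[folklore] analysis about ARBITRARY functions `G, g : ℤ⁴ → ℝ` under displayed rows; no `def`, no `Prop` mirror, no cited fact, 0 sorry.
0 wall binders instantiated; NOT D1, NOT `BetaPertH`, NOT continuum, NOT Clay.

ABSOLUTE RULE (cell charter, verbatim): «No internally-minted statement may enter as a cited fact. Every hypothesis is either kernel-proved in this
package or a verbatim quotation of a PUBLISHED theorem with page reference. The manuscript(s) under audit are NOT citable for their own disputed steps —
they are the thing under adjudication; programme-internal (2001/route/tribunal) claims are never citable.»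

CONTENT ([folklore] throughout; `φ(v) := v_μv_ν·Q_G(v)`, `Q_G(v) = 8N²(G(v+e_ν+e_μ) + G(v+e_ν)) − 4N²G(v)`, `ψ := F_μ(G − g)` — written out as explicit lambda expressions in every statement (no notation is declared); the
explicit expressions).  `abs_sbp_weight_le` (the weight difference `φ(w) − φ(w−e_ν)` pointwise); the section `Main` with the displayed rows of ONE profile `G`
against a reference `g` at a fixed `n ≥ 2`: `h0` (`|G − g| ≤ D₀∕n²`), `h1` (`|F_ρ(G − g)| ≤ D₁∕n³`) everywhere, `d0`∕`d1` (scale-`n` exponential tails off the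
origin), and for `g`: `|g| ≤ U₀`, `|g| ≤ C₂∕‖·‖²`, `|F g| ≤ C₃∕‖·‖³`; then `abs_Q_le_global`∕`abs_Q_le_tail`, **`summable_phi_mul`** (`φ·θ` summable for any bounded
`θ`), the window shell bound `sbp_window_shell` (`≤ K_S∕n` per shell, `K_S = 1600N²D₁(4(U₀+C₂) + D₀ + 8(2U₀+C₃) + D₁)`), the exterior pointwise bound
`sbp_tail_pt` (`E_S·e^{−(δ∕n)(r+1)}∕(r+1)⁴`, `E_S = 20N²e^{δ}(4A₀+8A₁)(8A₁+C₃)`), and **`abs_tsum_sbp_le`**: `|Σ_{w∈ℤ⁴} φ(w)(ψ(w+e_ν) − ψ(w))| ≤ K_S +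
80E_S(1 + n∕δ)∕(n+1)`.  The END is PART 4 `SbpScalarEnd.d1Drift_of_strongRoad_sbp`.
Unit `b2b-balaban-beta-d1-p2` (gen 13), road «BF-x» OWNER; `LEAVES-BFx.md` row «C3-SBP»; CENSUS-K6a §v4.22.
-/

noncomputable section

open Finset Filter Topology
open scoped BigOperators
open Literature.Probability.LatticeModels (annulus box)
open Literature.MathematicalPhysics.QuantumFieldTheory.Balaban1983to89
open Literature.MathematicalPhysics.QuantumFieldTheory.Balaban1983to89.Beta
open B12Sec2to5 (l1 l1_nonneg)
open DyadicShell (Pt toReal supNorm mem_annulus_iff ne_zero_of_mem_annulus supNorm_eq_of_mem_sphere supNorm_eq_zero_iff natAbs_le_supNorm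
  toReal_apply)
open BubbleTransfer (Leg unitVec)
open TwoPowerLegs (free freeMixedLeg supNorm_sub_le_supNorm_add supNorm_unitVec abs_latticeGreen_half_le freeMixedLeg_a free_g)
open GhostTable (gFree mixedDiffFun fwdDiffFun cellForm freeMixedLeg_f)
open SquareTable (stK stK_eq_closedForm mixedDiffFun_sq)
open WindowIdentification (fullSum psum)
open ExpKernelCalculus (summable_exp_shift')
open Summit.QuantumFields.BalabanUV.Beta.D1BFx.SbpShellAlgebra

namespace Summit.QuantumFields.BalabanUV.Beta.D1BFx.SbpShellTerm

variable {μ ν : Fin 4}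

section Weight

/-- [folklore] **THE SUMMATION-BY-PARTS WEIGHT DIFFERENCE, POINTWISE**: with `φ(v) := v_μ v_ν·Q_G(v)`, `Q_G(v) = 8N²(G(v+e_ν+e_μ) + G(v+e_ν)) − 4N²G(v)`,
on the shell `‖w‖∞ = r+1`: `|φ(w−e_ν) − φ(w)| ≤ (r+1)·(20N²X + (r+1)·20N²Y)` whenever the three values of `G` at `w+e_μ, w, w−e_ν` are `≤ X` and the three
`ν`-differences at `w+e_μ, w, w−e_ν` are `≤ Y` (`φ(w) − φ(w−e_ν) = w_μ[Q_G(w−e_ν) + w_ν(Q_G(w) − Q_G(w−e_ν))]`, `μ ≠ ν`). -/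
theorem abs_sbp_weight_le (hμν : μ ≠ ν) (N : ℝ) (G : Pt → ℝ) {r : ℕ} {w : Pt} (hw : w ∈ annulus 4 r (r + 1)) {X Y : ℝ}
    (q1 : |G (w + unitVec μ)| ≤ X) (q2 : |G w| ≤ X) (q3 : |G (w - unitVec ν)| ≤ X)
    (p1 : |G (w + unitVec ν + unitVec μ) - G (w + unitVec μ)| ≤ Y) (p2 : |G (w + unitVec ν) - G w| ≤ Y)
    (p3 : |G w - G (w - unitVec ν)| ≤ Y) :
    |toReal (w - unitVec ν) μ * toReal (w - unitVec ν) ν *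
          (8 * N ^ 2 * (G (w - unitVec ν + unitVec ν + unitVec μ) + G (w - unitVec ν + unitVec ν)) - 4 * N ^ 2 * G (w - unitVec ν)) -
        toReal w μ * toReal w ν * (8 * N ^ 2 * (G (w + unitVec ν + unitVec μ) + G (w + unitVec ν)) - 4 * N ^ 2 * G w)|
      ≤ ((r : ℝ) + 1) * (20 * N ^ 2 * X + ((r : ℝ) + 1) * (20 * N ^ 2 * Y)) := by
  rw [sub_add_cancel, toReal_sub_unitVec_ne hμν, toReal_sub_unitVec_self]
  have hsup : (supNorm w : ℝ) = (r : ℝ) + 1 := by rw [supNorm_eq_of_mem_sphere hw]; push_cast; ring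
  have ha : |toReal w μ| ≤ (r : ℝ) + 1 := hsup ▸ abs_toReal_le w μ
  have hb : |toReal w ν| ≤ (r : ℝ) + 1 := hsup ▸ abs_toReal_le w ν
  have hN : (0 : ℝ) ≤ N ^ 2 := sq_nonneg N
  set a := toReal w μ
  set b := toReal w ν
  set Q' := 8 * N ^ 2 * (G (w + unitVec μ) + G w) - 4 * N ^ 2 * G (w - unitVec ν) with hQ'
  set Q := 8 * N ^ 2 * (G (w + unitVec ν + unitVec μ) + G (w + unitVec ν)) - 4 * N ^ 2 * G w with hQ
  have hQ'b : |Q'| ≤ 20 * N ^ 2 * X := by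
    have h1 : |8 * N ^ 2 * (G (w + unitVec μ) + G w)| ≤ 8 * N ^ 2 * (X + X) := by
      rw [abs_mul, abs_of_nonneg (by positivity : (0 : ℝ) ≤ 8 * N ^ 2)]
      exact mul_le_mul_of_nonneg_left ((abs_add_le _ _).trans (add_le_add q1 q2)) (by positivity)
    have h2 : |4 * N ^ 2 * G (w - unitVec ν)| ≤ 4 * N ^ 2 * X := by
      rw [abs_mul, abs_of_nonneg (by positivity : (0 : ℝ) ≤ 4 * N ^ 2)]
      exact mul_le_mul_of_nonneg_left q3 (by positivity)
    calc |Q'| ≤ |8 * N ^ 2 * (G (w + unitVec μ) + G w)| + |4 * N ^ 2 * G (w - unitVec ν)| := abs_sub _ _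
      _ ≤ 8 * N ^ 2 * (X + X) + 4 * N ^ 2 * X := add_le_add h1 h2
      _ = 20 * N ^ 2 * X := by ring
  have hQQ : |Q - Q'| ≤ 20 * N ^ 2 * Y := by
    have e : Q - Q' = 8 * N ^ 2 * ((G (w + unitVec ν + unitVec μ) - G (w + unitVec μ)) + (G (w + unitVec ν) - G w)) -
        4 * N ^ 2 * (G w - G (w - unitVec ν)) := by rw [hQ, hQ']; ring
    rw [e]
    have h1 : |8 * N ^ 2 * ((G (w + unitVec ν + unitVec μ) - G (w + unitVec μ)) + (G (w + unitVec ν) - G w))| ≤ 8 * N ^ 2 * (Y + Y) := by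
      rw [abs_mul, abs_of_nonneg (by positivity : (0 : ℝ) ≤ 8 * N ^ 2)]
      exact mul_le_mul_of_nonneg_left ((abs_add_le _ _).trans (add_le_add p1 p2)) (by positivity)
    have h2 : |4 * N ^ 2 * (G w - G (w - unitVec ν))| ≤ 4 * N ^ 2 * Y := by
      rw [abs_mul, abs_of_nonneg (by positivity : (0 : ℝ) ≤ 4 * N ^ 2)]
      exact mul_le_mul_of_nonneg_left p3 (by positivity)
    calc _ ≤ |8 * N ^ 2 * ((G (w + unitVec ν + unitVec μ) - G (w + unitVec μ)) + (G (w + unitVec ν) - G w))| +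
          |4 * N ^ 2 * (G w - G (w - unitVec ν))| := abs_sub _ _
      _ ≤ 8 * N ^ 2 * (Y + Y) + 4 * N ^ 2 * Y := add_le_add h1 h2
      _ = 20 * N ^ 2 * Y := by ring
  have e : a * (b - 1) * Q' - a * b * Q = -(a * (Q' + b * (Q - Q'))) := by ring
  rw [e, abs_neg, abs_mul]
  have h3 : |Q' + b * (Q - Q')| ≤ 20 * N ^ 2 * X + ((r : ℝ) + 1) * (20 * N ^ 2 * Y) := by
    calc |Q' + b * (Q - Q')| ≤ |Q'| + |b * (Q - Q')| := abs_add_le _ _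
      _ = |Q'| + |b| * |Q - Q'| := by rw [abs_mul]
      _ ≤ 20 * N ^ 2 * X + ((r : ℝ) + 1) * (20 * N ^ 2 * Y) :=
          add_le_add hQ'b (mul_le_mul hb hQQ (abs_nonneg _) (by positivity))
  exact mul_le_mul ha h3 (abs_nonneg _) (by positivity)

end Weight

/-! ## §4 The estimates for one profile `G` against a reference `g` (later `g := gFree`) at a fixed blocking factor `n ≥ 2` -/

section Main

variable (hμν : μ ≠ ν) (N : ℝ) {n : ℕ} (hn : 2 ≤ n) (G g : Pt → ℝ) {U0 C2 C3 C4 D0 D1 A0 A1 δ : ℝ}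
  (hU0 : 0 ≤ U0) (hC2 : 0 ≤ C2) (hC3 : 0 ≤ C3) (hC4 : 0 ≤ C4) (hD0 : 0 ≤ D0) (hD1 : 0 ≤ D1) (hA0 : 0 ≤ A0) (hA1 : 0 ≤ A1) (hδ : 0 < δ)
  (hgU : ∀ v, |g v| ≤ U0) (hg2 : ∀ v : Pt, v ≠ 0 → |g v| ≤ C2 / (supNorm v : ℝ) ^ 2)
  (hg3 : ∀ v : Pt, v ≠ 0 → ∀ ρ : Fin 4, |g (v + unitVec ρ) - g v| ≤ C3 / (supNorm v : ℝ) ^ 3)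
  (hg4 : ∀ v : Pt, v ≠ 0 → |mixedDiffFun g (unitVec μ) (unitVec ν) v| ≤ C4 / (supNorm v : ℝ) ^ 4)
  (h0 : ∀ v, |G v - g v| ≤ D0 / (n : ℝ) ^ 2)
  (h1 : ∀ v (ρ : Fin 4), |(G (v + unitVec ρ) - g (v + unitVec ρ)) - (G v - g v)| ≤ D1 / (n : ℝ) ^ 3)
  (d0 : ∀ v : Pt, v ≠ 0 → |G v| ≤ A0 * Real.exp (-(δ / n) * supNorm v) / (supNorm v : ℝ) ^ 2)
  (d1 : ∀ v : Pt, v ≠ 0 → ∀ ρ : Fin 4, |G (v + unitVec ρ) - G v| ≤ A1 * Real.exp (-(δ / n) * supNorm v) / (supNorm v : ℝ) ^ 3)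



include hn in
/-- [folklore] `n` as a real is positive and `≥ 1`, `δ/n ≤ δ`, `e^{δ/n} ≤ e^{δ}`. -/
theorem n_facts (hδ : 0 < δ) : (0 : ℝ) < n ∧ (1 : ℝ) ≤ n ∧ 0 ≤ δ / n ∧ Real.exp (δ / n) ≤ Real.exp δ := by
  have h1 : (1 : ℝ) ≤ n := by exact_mod_cast (le_trans one_le_two hn)
  have h0 : (0 : ℝ) < n := by linarith
  refine ⟨h0, h1, by positivity, Real.exp_le_exp.mpr ?_⟩
  rw [div_le_iff₀ h0]
  nlinarith

/-- [folklore] `t^k / n^(k+1) ≤ 1/n` for `0 < t ≤ n`. -/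
theorem pow_div_pow_succ_le {t m : ℝ} (ht : 0 < t) (htm : t ≤ m) (k : ℕ) : t ^ k / m ^ (k + 1) ≤ 1 / m := by
  have hm : 0 < m := lt_of_lt_of_le ht htm
  rw [div_le_div_iff₀ (by positivity) hm, one_mul, pow_succ]
  exact mul_le_mul_of_nonneg_right (pow_le_pow_left₀ ht.le htm k) hm.le

include h0 hgU in
/-- [folklore] `|G| ≤ U₀ + D₀/n²` everywhere. -/
theorem abs_G_le_global (v : Pt) : |G v| ≤ U0 + D0 / (n : ℝ) ^ 2 := by
  have h := h0 v
  have hg := hgU v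
  have : |G v| ≤ |g v| + |G v - g v| := by
    calc |G v| = |g v + (G v - g v)| := by ring_nf
      _ ≤ |g v| + |G v - g v| := abs_add_le _ _
  linarith

include h0 hgU in
/-- [folklore] `|Q_G| ≤ 20N²(U₀ + D₀/n²)` everywhere. -/
theorem abs_Q_le_global (v : Pt) :
    |8 * N ^ 2 * (G (v + unitVec ν + unitVec μ) + G (v + unitVec ν)) - 4 * N ^ 2 * G v| ≤ 20 * N ^ 2 * (U0 + D0 / (n : ℝ) ^ 2) := by
  have q1 := abs_G_le_global G g hgU h0 (v + unitVec ν + unitVec μ)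
  have q2 := abs_G_le_global G g hgU h0 (v + unitVec ν)
  have q3 := abs_G_le_global G g hgU h0 v
  have hN : (0 : ℝ) ≤ N ^ 2 := sq_nonneg N
  have e1 : |8 * N ^ 2 * (G (v + unitVec ν + unitVec μ) + G (v + unitVec ν))| ≤ 8 * N ^ 2 * ((U0 + D0 / (n : ℝ) ^ 2) + (U0 + D0 / (n : ℝ) ^ 2)) := by
    rw [abs_mul, abs_of_nonneg (by positivity : (0 : ℝ) ≤ 8 * N ^ 2)]
    exact mul_le_mul_of_nonneg_left ((abs_add_le _ _).trans (add_le_add q1 q2)) (by positivity)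
  have e2 : |4 * N ^ 2 * G v| ≤ 4 * N ^ 2 * (U0 + D0 / (n : ℝ) ^ 2) := by
    rw [abs_mul, abs_of_nonneg (by positivity : (0 : ℝ) ≤ 4 * N ^ 2)]
    exact mul_le_mul_of_nonneg_left q3 (by positivity)
  calc _ ≤ |8 * N ^ 2 * (G (v + unitVec ν + unitVec μ) + G (v + unitVec ν))| + |4 * N ^ 2 * G v| := abs_sub _ _
    _ ≤ _ := add_le_add e1 e2
    _ = 20 * N ^ 2 * (U0 + D0 / (n : ℝ) ^ 2) := by ring

include hμν hn hA0 hδ d0 in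
/-- [folklore] `|Q_G(w)| ≤ 80N²A₀e^{δ/n}·e^{−(δ/n)(r+1)}/(r+1)²` on the shell `r + 1`, `r ≥ 1`. -/
theorem abs_Q_le_tail {r : ℕ} (hr : 1 ≤ r) {w : Pt} (hw : w ∈ annulus 4 r (r + 1)) :
    |8 * N ^ 2 * (G (w + unitVec ν + unitVec μ) + G (w + unitVec ν)) - 4 * N ^ 2 * G w| ≤
      80 * N ^ 2 * A0 * Real.exp (δ / n) * Real.exp (-(δ / n) * ((r : ℝ) + 1)) / ((r : ℝ) + 1) ^ 2 := by
  obtain ⟨_, _, hc, _⟩ := n_facts hn hδ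
  obtain ⟨hs0, hsμ, hsν, hsνμ, _⟩ := supNorm_shifts_le_one hμν
  have q1 := abs_G_shift_le_tail hA0 hc d0 hr hw hsνμ
  have q2 := abs_G_shift_le_tail hA0 hc d0 hr hw hsν
  have q3 := abs_G_shift_le_tail hA0 hc d0 hr hw hs0
  rw [add_zero] at q3
  rw [← add_assoc] at q1
  set X := 4 * A0 * Real.exp (δ / n) * Real.exp (-(δ / n) * ((r : ℝ) + 1)) / ((r : ℝ) + 1) ^ 2 with hX
  have hX0 : 0 ≤ X := by rw [hX]; positivity
  have e1 : |8 * N ^ 2 * (G (w + unitVec ν + unitVec μ) + G (w + unitVec ν))| ≤ 8 * N ^ 2 * (X + X) := by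
    rw [abs_mul, abs_of_nonneg (by positivity : (0 : ℝ) ≤ 8 * N ^ 2)]
    exact mul_le_mul_of_nonneg_left ((abs_add_le _ _).trans (add_le_add q1 q2)) (by positivity)
  have e2 : |4 * N ^ 2 * G w| ≤ 4 * N ^ 2 * X := by
    rw [abs_mul, abs_of_nonneg (by positivity : (0 : ℝ) ≤ 4 * N ^ 2)]
    exact mul_le_mul_of_nonneg_left q3 (by positivity)
  calc _ ≤ |8 * N ^ 2 * (G (w + unitVec ν + unitVec μ) + G (w + unitVec ν))| + |4 * N ^ 2 * G w| := abs_sub _ _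
    _ ≤ 8 * N ^ 2 * (X + X) + 4 * N ^ 2 * X := add_le_add e1 e2
    _ = _ := by rw [hX]; ring

include hμν hn hU0 hD0 hA0 hδ hgU h0 d0 in
/-- [folklore] **SUMMABILITY OF `φ·θ` FOR ANY BOUNDED `θ`** (the weight factor decays at scale `n`; n-dependent constants). -/
theorem summable_phi_mul (θ : Pt → ℝ) {Bθ : ℝ} (hBθ : 0 ≤ Bθ) (hθ : ∀ v, |θ v| ≤ Bθ) : Summable fun w => (fun v : Pt => toReal v μ * toReal v ν * (8 * N ^ 2 * (G (v + unitVec ν + unitVec μ) + G (v + unitVec ν)) - 4 * N ^ 2 * G v)) w * θ w := by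
  obtain ⟨hn0, hn1, hc, _⟩ := n_facts hn hδ
  have hc0 : 0 < δ / n := by positivity
  set BG := U0 + D0 / (n : ℝ) ^ 2 with hBG
  have hBG0 : 0 ≤ BG := by rw [hBG]; positivity
  -- pointwise bounds on shells
  have hsup : ∀ {r : ℕ} {w : Pt}, w ∈ annulus 4 r (r + 1) → (supNorm w : ℝ) = (r : ℝ) + 1 := fun hw => by
    rw [supNorm_eq_of_mem_sphere hw]; push_cast; ring
  have hwt : ∀ {r : ℕ} {w : Pt}, w ∈ annulus 4 r (r + 1) → |toReal w μ * toReal w ν| ≤ ((r : ℝ) + 1) ^ 2 := fun {r w} hw => by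
    rw [abs_mul, sq]
    exact mul_le_mul (hsup hw ▸ abs_toReal_le w μ) (hsup hw ▸ abs_toReal_le w ν) (abs_nonneg _) (by positivity)
  refine Summable.of_abs ?_
  refine (summable_and_tsum_le_of_shellBounds (K := fun w => |(fun v : Pt => toReal v μ * toReal v ν * (8 * N ^ 2 * (G (v + unitVec ν + unitVec μ) + G (v + unitVec ν)) - 4 * N ^ 2 * G v)) w * θ w|) (fun w => abs_nonneg _) ?_ (n := n) (by exact_mod_cast hn1)
    (Dw := 80 * (n : ℝ) ^ 6 * (20 * N ^ 2 * BG) * Bθ) (E := 80 * N ^ 2 * A0 * Real.exp (δ / n) * Bθ * ((Nat.factorial 4 : ℝ) / (δ / n / 2) ^ 4))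
    (δ := δ / 2) (Lr := n) (by positivity) (by positivity) (by positivity) hn0 ?_ ?_).1
  · simp [DyadicShell.toReal]
  · -- window shells
    intro r hr
    have ht : ((r : ℝ) + 1) ≤ n := by exact_mod_cast hr
    have hpt : ∀ w ∈ annulus 4 r (r + 1), |(fun v : Pt => toReal v μ * toReal v ν * (8 * N ^ 2 * (G (v + unitVec ν + unitVec μ) + G (v + unitVec ν)) - 4 * N ^ 2 * G v)) w * θ w| ≤ (n : ℝ) ^ 2 * (20 * N ^ 2 * BG) * Bθ := by
      intro w hw
      show |toReal w μ * toReal w ν * (8 * N ^ 2 * (G (w + unitVec ν + unitVec μ) + G (w + unitVec ν)) - 4 * N ^ 2 * G w) * θ w| ≤ _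
      rw [abs_mul, abs_mul]
      have h2 : ((r : ℝ) + 1) ^ 2 ≤ (n : ℝ) ^ 2 := pow_le_pow_left₀ (by positivity) ht 2
      exact mul_le_mul (mul_le_mul ((hwt hw).trans h2) (abs_Q_le_global N G g hgU h0 w) (abs_nonneg _) (by positivity)) (hθ w)
        (abs_nonneg _) (by positivity)
    refine (ShellStencils.shell_sum_le_of_pointwise (by positivity) hpt).trans ?_
    have h3 : ((r : ℝ) + 1) ^ 3 ≤ (n : ℝ) ^ 3 := pow_le_pow_left₀ (by positivity) ht 3
    rw [le_div_iff₀ hn0]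
    calc 80 * ((r : ℝ) + 1) ^ 3 * ((n : ℝ) ^ 2 * (20 * N ^ 2 * BG) * Bθ) * n
        ≤ 80 * (n : ℝ) ^ 3 * ((n : ℝ) ^ 2 * (20 * N ^ 2 * BG) * Bθ) * n := by gcongr
      _ = 80 * (n : ℝ) ^ 6 * (20 * N ^ 2 * BG) * Bθ := by ring
  · -- exterior shells: split the exponential, absorb `(r+1)^4` into one half
    intro r hr w hw
    have hr1 : 1 ≤ r := le_trans (le_trans one_le_two hn) hr
    show |toReal w μ * toReal w ν * (8 * N ^ 2 * (G (w + unitVec ν + unitVec μ) + G (w + unitVec ν)) - 4 * N ^ 2 * G w) * θ w| ≤ _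
    rw [abs_mul, abs_mul]
    have hQ := abs_Q_le_tail hμν N hn G hA0 hδ d0 hr1 hw
    have ht0 : (0 : ℝ) < (r : ℝ) + 1 := by positivity
    set t := (r : ℝ) + 1 with htdef
    have hE : Real.exp (-(δ / n) * t) = Real.exp (-(δ / n / 2) * t) * Real.exp (-(δ / 2 / n) * t) := by
      rw [← Real.exp_add]; congr 1; ring
    have hkey : t ^ 4 * Real.exp (-(δ / n / 2) * t) ≤ (Nat.factorial 4 : ℝ) / (δ / n / 2) ^ 4 :=
      pow_mul_exp_neg_le ht0.le (by positivity) 4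
    calc |toReal w μ * toReal w ν| * |8 * N ^ 2 * (G (w + unitVec ν + unitVec μ) + G (w + unitVec ν)) - 4 * N ^ 2 * G w| * |θ w|
        ≤ t ^ 2 * (80 * N ^ 2 * A0 * Real.exp (δ / n) * Real.exp (-(δ / n) * t) / t ^ 2) * Bθ :=
          mul_le_mul (mul_le_mul (hwt hw) hQ (abs_nonneg _) (by positivity)) (hθ w) (abs_nonneg _) (by positivity)
      _ = 80 * N ^ 2 * A0 * Real.exp (δ / n) * Bθ * (t ^ 4 * Real.exp (-(δ / n / 2) * t)) / t ^ 4 * Real.exp (-(δ / 2 / n) * t) := by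
          rw [hE]; field_simp
      _ ≤ 80 * N ^ 2 * A0 * Real.exp (δ / n) * Bθ * ((Nat.factorial 4 : ℝ) / (δ / n / 2) ^ 4) / t ^ 4 * Real.exp (-(δ / 2 / n) * t) := by
          gcongr

include hμν hn hU0 hC2 hC3 hD0 hD1 hgU hg2 hg3 h0 h1 in
/-- [folklore] **THE SUMMATION-BY-PARTS INTEGRAND ON A WINDOW SHELL** (`r + 1 ≤ n`): `Σ_{‖w‖∞=r+1} |(φ(w−e_ν) − φ(w))·ψ(w)| ≤ K_S/n`,
`K_S = 1600N²D₁(4(U₀+C₂) + D₀ + 8(2U₀+C₃) + D₁)` (rows `h0`/`h1` + the free-leg decay; `|ψ| ≤ D₁/n³` everywhere). -/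
theorem sbp_window_shell {r : ℕ} (hr : r + 1 ≤ n) :
    ∑ w ∈ annulus 4 r (r + 1), |((fun v : Pt => toReal v μ * toReal v ν * (8 * N ^ 2 * (G (v + unitVec ν + unitVec μ) + G (v + unitVec ν)) - 4 * N ^ 2 * G v)) (w - unitVec ν) - (fun v : Pt => toReal v μ * toReal v ν * (8 * N ^ 2 * (G (v + unitVec ν + unitVec μ) + G (v + unitVec ν)) - 4 * N ^ 2 * G v)) w) * (fun v : Pt => (G (v + unitVec μ) - g (v + unitVec μ)) - (G v - g v)) w| ≤
      1600 * N ^ 2 * D1 * (4 * (U0 + C2) + D0 + 8 * (2 * U0 + C3) + D1) / n := by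
  have hn1 : (1 : ℝ) ≤ n := by exact_mod_cast (le_trans one_le_two hn)
  have hn0 : (0 : ℝ) < n := by linarith
  have ht0 : (0 : ℝ) < (r : ℝ) + 1 := by positivity
  have htn : (r : ℝ) + 1 ≤ n := by exact_mod_cast hr
  obtain ⟨hs0, hsμ, hsν, hsνμ, hsn⟩ := supNorm_shifts_le_one hμν
  set t := (r : ℝ) + 1 with ht
  set X := 4 * (U0 + C2) / t ^ 2 + D0 / (n : ℝ) ^ 2 with hX
  set Y := 8 * (2 * U0 + C3) / t ^ 3 + D1 / (n : ℝ) ^ 3 with hY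
  have hX0 : 0 ≤ X := by rw [hX]; positivity
  have hY0 : 0 ≤ Y := by rw [hY]; positivity
  have hpt : ∀ w ∈ annulus 4 r (r + 1), |((fun v : Pt => toReal v μ * toReal v ν * (8 * N ^ 2 * (G (v + unitVec ν + unitVec μ) + G (v + unitVec ν)) - 4 * N ^ 2 * G v)) (w - unitVec ν) - (fun v : Pt => toReal v μ * toReal v ν * (8 * N ^ 2 * (G (v + unitVec ν + unitVec μ) + G (v + unitVec ν)) - 4 * N ^ 2 * G v)) w) * (fun v : Pt => (G (v + unitVec μ) - g (v + unitVec μ)) - (G v - g v)) w| ≤ t * (20 * N ^ 2 * X + t * (20 * N ^ 2 * Y)) * (D1 / (n : ℝ) ^ 3) := by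
    intro w hw
    have q1 := abs_G_shift_le_window hU0 hC2 hgU hg2 h0 hw hsμ
    have q2 := abs_G_shift_le_window hU0 hC2 hgU hg2 h0 hw hs0
    rw [add_zero] at q2
    have q3 := abs_G_shift_le_window hU0 hC2 hgU hg2 h0 hw hsn
    rw [← sub_eq_add_neg] at q3
    have p1 := abs_dG_shift_le_window hU0 hC3 hgU hg3 h1 hw hsμ ν
    rw [add_right_comm w (unitVec μ) (unitVec ν)] at p1
    have p2 := abs_dG_shift_le_window hU0 hC3 hgU hg3 h1 hw hs0 ν
    simp only [add_zero] at p2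
    have p3 := abs_dG_shift_le_window hU0 hC3 hgU hg3 h1 hw hsn ν
    rw [← sub_eq_add_neg, sub_add_cancel] at p3
    have hφ := abs_sbp_weight_le hμν N G hw q1 q2 q3 p1 p2 p3
    have hψ := h1 w μ
    rw [abs_mul]
    exact mul_le_mul hφ hψ (abs_nonneg _) (by positivity)
  refine (ShellStencils.shell_sum_le_of_pointwise (by positivity) hpt).trans ?_
  have f2 := pow_div_pow_succ_le ht0 htn 2
  have f4 := pow_div_pow_succ_le ht0 htn 4
  have f5 := pow_div_pow_succ_le ht0 htn 5
  have key : 80 * t ^ 3 * (t * (20 * N ^ 2 * X + t * (20 * N ^ 2 * Y)) * (D1 / (n : ℝ) ^ 3)) =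
      1600 * N ^ 2 * D1 * (4 * (U0 + C2) * (t ^ 2 / (n : ℝ) ^ (2 + 1)) + D0 * (t ^ 4 / (n : ℝ) ^ (4 + 1)) +
        8 * (2 * U0 + C3) * (t ^ 2 / (n : ℝ) ^ (2 + 1)) + D1 * (t ^ 5 / (n : ℝ) ^ (5 + 1))) := by
    rw [hX, hY]
    field_simp
    ring
  rw [key]
  have hN : (0 : ℝ) ≤ N ^ 2 := sq_nonneg N
  have i1 : 4 * (U0 + C2) * (t ^ 2 / (n : ℝ) ^ (2 + 1)) ≤ 4 * (U0 + C2) * (1 / n) := mul_le_mul_of_nonneg_left f2 (by positivity)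
  have i2 : D0 * (t ^ 4 / (n : ℝ) ^ (4 + 1)) ≤ D0 * (1 / n) := mul_le_mul_of_nonneg_left f4 hD0
  have i3 : 8 * (2 * U0 + C3) * (t ^ 2 / (n : ℝ) ^ (2 + 1)) ≤ 8 * (2 * U0 + C3) * (1 / n) := mul_le_mul_of_nonneg_left f2 (by positivity)
  have i4 : D1 * (t ^ 5 / (n : ℝ) ^ (5 + 1)) ≤ D1 * (1 / n) := mul_le_mul_of_nonneg_left f5 hD1
  calc 1600 * N ^ 2 * D1 * (4 * (U0 + C2) * (t ^ 2 / (n : ℝ) ^ (2 + 1)) + D0 * (t ^ 4 / (n : ℝ) ^ (4 + 1)) +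
          8 * (2 * U0 + C3) * (t ^ 2 / (n : ℝ) ^ (2 + 1)) + D1 * (t ^ 5 / (n : ℝ) ^ (5 + 1)))
      ≤ 1600 * N ^ 2 * D1 * (4 * (U0 + C2) * (1 / n) + D0 * (1 / n) + 8 * (2 * U0 + C3) * (1 / n) + D1 * (1 / n)) := by
        apply mul_le_mul_of_nonneg_left _ (by positivity)
        linarith
    _ = 1600 * N ^ 2 * D1 * (4 * (U0 + C2) + D0 + 8 * (2 * U0 + C3) + D1) / n := by ring

include hμν hn hC3 hA0 hA1 hδ hg3 d0 d1 in
/-- [folklore] **THE SUMMATION-BY-PARTS INTEGRAND ON AN EXTERIOR SHELL** (`r ≥ n`): `|(φ(w−e_ν) − φ(w))·ψ(w)| ≤ E_S·e^{−(δ/n)(r+1)}/(r+1)⁴`,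
`E_S = 20N²e^{δ}(4A₀ + 8A₁)(8A₁ + C₃)` (rows `d0`/`d1` keep one exponential; `|ψ| ≤ (8A₁ + C₃)/(r+1)³`). -/
theorem sbp_tail_pt {r : ℕ} (hr : n ≤ r) {w : Pt} (hw : w ∈ annulus 4 r (r + 1)) :
    |((fun v : Pt => toReal v μ * toReal v ν * (8 * N ^ 2 * (G (v + unitVec ν + unitVec μ) + G (v + unitVec ν)) - 4 * N ^ 2 * G v)) (w - unitVec ν) - (fun v : Pt => toReal v μ * toReal v ν * (8 * N ^ 2 * (G (v + unitVec ν + unitVec μ) + G (v + unitVec ν)) - 4 * N ^ 2 * G v)) w) * (fun v : Pt => (G (v + unitVec μ) - g (v + unitVec μ)) - (G v - g v)) w| ≤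
      20 * N ^ 2 * Real.exp δ * (4 * A0 + 8 * A1) * (8 * A1 + C3) / ((r : ℝ) + 1) ^ 4 * Real.exp (-(δ / n) * ((r : ℝ) + 1)) := by
  obtain ⟨hn0, hn1, hc, hexp⟩ := n_facts hn hδ
  have hr1 : 1 ≤ r := le_trans (le_trans one_le_two hn) hr
  have ht0 : (0 : ℝ) < (r : ℝ) + 1 := by positivity
  obtain ⟨hs0, hsμ, hsν, hsνμ, hsn⟩ := supNorm_shifts_le_one hμν
  set t := (r : ℝ) + 1 with ht
  set Ex := Real.exp (-(δ / n) * t) with hEx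
  set X := 4 * A0 * Real.exp (δ / n) * Ex / t ^ 2 with hX
  set Y := 8 * A1 * Real.exp (δ / n) * Ex / t ^ 3 with hY
  have q1 := abs_G_shift_le_tail hA0 hc d0 hr1 hw hsμ
  have q2 := abs_G_shift_le_tail hA0 hc d0 hr1 hw hs0
  rw [add_zero] at q2
  have q3 := abs_G_shift_le_tail hA0 hc d0 hr1 hw hsn
  rw [← sub_eq_add_neg] at q3
  have p1 := abs_dG_shift_le_tail hA1 hc d1 hr1 hw hsμ ν
  rw [add_right_comm w (unitVec μ) (unitVec ν)] at p1
  have p2 := abs_dG_shift_le_tail hA1 hc d1 hr1 hw hs0 ν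
  simp only [add_zero] at p2
  have p3 := abs_dG_shift_le_tail hA1 hc d1 hr1 hw hsn ν
  rw [← sub_eq_add_neg, sub_add_cancel] at p3
  have hφ := abs_sbp_weight_le hμν N G hw q1 q2 q3 p1 p2 p3
  -- the first difference of the correction: `|ψ(w)| ≤ (8A₁ + C₃)/t³`
  have hw0 : w ≠ 0 := ne_zero_of_mem_annulus hw
  have hsup : (supNorm w : ℝ) = t := by rw [ht, supNorm_eq_of_mem_sphere hw]; push_cast; ring
  have hG1 := abs_dG_shift_le_tail' hA1 hc d1 hr1 hw hs0 μ
  simp only [add_zero] at hG1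
  have hg1 := hg3 w hw0 μ
  rw [hsup] at hg1
  have hψ : |(fun v : Pt => (G (v + unitVec μ) - g (v + unitVec μ)) - (G v - g v)) w| ≤ (8 * A1 + C3) / t ^ 3 := by
    show |(G (w + unitVec μ) - g (w + unitVec μ)) - (G w - g w)| ≤ _
    calc |(G (w + unitVec μ) - g (w + unitVec μ)) - (G w - g w)| = |(G (w + unitVec μ) - G w) - (g (w + unitVec μ) - g w)| := by ring_nf
      _ ≤ |G (w + unitVec μ) - G w| + |g (w + unitVec μ) - g w| := abs_sub _ _
      _ ≤ 8 * A1 / t ^ 3 + C3 / t ^ 3 := add_le_add hG1 hg1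
      _ = (8 * A1 + C3) / t ^ 3 := by ring
  rw [abs_mul]
  calc |(fun v : Pt => toReal v μ * toReal v ν * (8 * N ^ 2 * (G (v + unitVec ν + unitVec μ) + G (v + unitVec ν)) - 4 * N ^ 2 * G v)) (w - unitVec ν) - (fun v : Pt => toReal v μ * toReal v ν * (8 * N ^ 2 * (G (v + unitVec ν + unitVec μ) + G (v + unitVec ν)) - 4 * N ^ 2 * G v)) w| * |(fun v : Pt => (G (v + unitVec μ) - g (v + unitVec μ)) - (G v - g v)) w| ≤ t * (20 * N ^ 2 * X + t * (20 * N ^ 2 * Y)) * ((8 * A1 + C3) / t ^ 3) :=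
        mul_le_mul hφ hψ (abs_nonneg _) (by positivity)
    _ = 20 * N ^ 2 * Real.exp (δ / n) * (4 * A0 + 8 * A1) * (8 * A1 + C3) / t ^ 4 * Ex := by
        rw [hX, hY]; field_simp
    _ ≤ 20 * N ^ 2 * Real.exp δ * (4 * A0 + 8 * A1) * (8 * A1 + C3) / t ^ 4 * Ex := by gcongr

include hμν hn hU0 hC2 hC3 hD0 hD1 hA0 hA1 hδ hgU hg2 hg3 h0 h1 d0 d1 in
/-- [folklore] **THE SUMMATION-BY-PARTS TERM IS `O(1)` UNIFORMLY IN `n`**: `|Σ_{w∈ℤ⁴} φ(w)·(ψ(w+e_ν) − ψ(w))| ≤ K_S + 80E_S(1 + n/δ)/(n+1)`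
(Abel summation with no boundary `tsum_mul_shift_sub`, the two products summable by `summable_phi_mul`; the shell bounds `sbp_window_shell` ∕ `sbp_tail_pt`). -/
theorem abs_tsum_sbp_le :
    |∑' w, (fun v : Pt => toReal v μ * toReal v ν * (8 * N ^ 2 * (G (v + unitVec ν + unitVec μ) + G (v + unitVec ν)) - 4 * N ^ 2 * G v)) w * ((fun v : Pt => (G (v + unitVec μ) - g (v + unitVec μ)) - (G v - g v)) (w + unitVec ν) - (fun v : Pt => (G (v + unitVec μ) - g (v + unitVec μ)) - (G v - g v)) w)| ≤
      1600 * N ^ 2 * D1 * (4 * (U0 + C2) + D0 + 8 * (2 * U0 + C3) + D1) +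
        80 * (20 * N ^ 2 * Real.exp δ * (4 * A0 + 8 * A1) * (8 * A1 + C3)) * (1 + n / δ) / ((n : ℝ) + 1) := by
  obtain ⟨hn0, hn1, hc, hexp⟩ := n_facts hn hδ
  have hS1 : Summable fun w => (fun v : Pt => toReal v μ * toReal v ν * (8 * N ^ 2 * (G (v + unitVec ν + unitVec μ) + G (v + unitVec ν)) - 4 * N ^ 2 * G v)) w * (fun v : Pt => (G (v + unitVec μ) - g (v + unitVec μ)) - (G v - g v)) (w + unitVec ν) :=
    summable_phi_mul hμν N hn G g hU0 hD0 hA0 hδ hgU h0 d0 (fun v => (fun v : Pt => (G (v + unitVec μ) - g (v + unitVec μ)) - (G v - g v)) (v + unitVec ν)) (by positivity) (fun v => h1 (v + unitVec ν) μ)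
  have hS2 : Summable fun w => (fun v : Pt => toReal v μ * toReal v ν * (8 * N ^ 2 * (G (v + unitVec ν + unitVec μ) + G (v + unitVec ν)) - 4 * N ^ 2 * G v)) w * (fun v : Pt => (G (v + unitVec μ) - g (v + unitVec μ)) - (G v - g v)) w :=
    summable_phi_mul hμν N hn G g hU0 hD0 hA0 hδ hgU h0 d0 (fun v => (fun v : Pt => (G (v + unitVec μ) - g (v + unitVec μ)) - (G v - g v)) v) (by positivity) (fun v => h1 v μ)
  rw [tsum_mul_shift_sub (fun v : Pt => toReal v μ * toReal v ν * (8 * N ^ 2 * (G (v + unitVec ν + unitVec μ) + G (v + unitVec ν)) - 4 * N ^ 2 * G v)) (fun v : Pt => (G (v + unitVec μ) - g (v + unitVec μ)) - (G v - g v)) (unitVec ν) hS1 hS2]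
  have hK0 : (fun w => |((fun v : Pt => toReal v μ * toReal v ν * (8 * N ^ 2 * (G (v + unitVec ν + unitVec μ) + G (v + unitVec ν)) - 4 * N ^ 2 * G v)) (w - unitVec ν) - (fun v : Pt => toReal v μ * toReal v ν * (8 * N ^ 2 * (G (v + unitVec ν + unitVec μ) + G (v + unitVec ν)) - 4 * N ^ 2 * G v)) w) * (fun v : Pt => (G (v + unitVec μ) - g (v + unitVec μ)) - (G v - g v)) w|) 0 = 0 := by
    simp [DyadicShell.toReal, BubbleTransfer.unitVec, hμν]
  obtain ⟨hsum, hle⟩ := summable_and_tsum_le_of_shellBounds (K := fun w => |((fun v : Pt => toReal v μ * toReal v ν * (8 * N ^ 2 * (G (v + unitVec ν + unitVec μ) + G (v + unitVec ν)) - 4 * N ^ 2 * G v)) (w - unitVec ν) - (fun v : Pt => toReal v μ * toReal v ν * (8 * N ^ 2 * (G (v + unitVec ν + unitVec μ) + G (v + unitVec ν)) - 4 * N ^ 2 * G v)) w) * (fun v : Pt => (G (v + unitVec μ) - g (v + unitVec μ)) - (G v - g v)) w|)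
    (fun w => abs_nonneg _) hK0 (n := n) (by exact_mod_cast hn1) (by positivity) (by positivity) hδ hn0
    (fun r hr => sbp_window_shell hμν N hn G g hU0 hC2 hC3 hD0 hD1 hgU hg2 hg3 h0 h1 hr)
    (fun r hr w hw => sbp_tail_pt hμν N hn G g hC3 hA0 hA1 hδ hg3 d0 d1 hr hw)
  have hsum' : Summable fun w => ‖((fun v : Pt => toReal v μ * toReal v ν * (8 * N ^ 2 * (G (v + unitVec ν + unitVec μ) + G (v + unitVec ν)) - 4 * N ^ 2 * G v)) (w - unitVec ν) - (fun v : Pt => toReal v μ * toReal v ν * (8 * N ^ 2 * (G (v + unitVec ν + unitVec μ) + G (v + unitVec ν)) - 4 * N ^ 2 * G v)) w) * (fun v : Pt => (G (v + unitVec μ) - g (v + unitVec μ)) - (G v - g v)) w‖ := by simpa only [Real.norm_eq_abs] using hsum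
  have h := norm_tsum_le_tsum_norm hsum'
  simp only [Real.norm_eq_abs] at h
  exact h.trans hle

end Main

end Summit.QuantumFields.BalabanUV.Beta.D1BFx.SbpShellTerm

end
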